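import Mathlib
import Summits.MatrixMultiplication.MatrixMultiplication.Theorems.SnSubsetDichotomyPolynomialSlackLopsidedNearWall
import Summits.MatrixMultiplication.MatrixMultiplication.Theorems.SnSubsetDichotomyPolynomialSlackSpreadTriples

/-!
# Heavy quotients: the near-wall inequality with the spread parameters of the three quotient sets

Crux `Summit.MatrixMultiplication.MatrixMultiplication.Theses.SnSubsetDichotomy.PolynomialSlack`
(item `stmt-MatrixMultiplication-8306`), level-one programme, lead c4. For a parity-pure TPP triple
`S, T, U ⊆ S_n` (`n ≥ 40`) with `N = |S||T||U|`, quotient sizes `α = |S||T|`, `β = |T||U|`, `γ = |U||S|`, and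
SPREAD PARAMETERS `λ_A, λ_B, λ_C ≥ 1` of the three pair marginals (`m_{ST}(i,j) ≤ λ_A·α/n`,
`m_{TU}(i,j) ≤ λ_B·β/n`, `m_{US}(i,j) ≤ λ_C·γ/n` for all `i, j`; `λ = n!/α` is always admissible, `λ = 1` means a
level-one-flat quotient set), the pinning `levelOnePinning`, the counting identity `sixFoldFix_eq_tripleSum`, the
centring identity `centered_tripleSum_eq`, the positivity inequality `neg_tripleSum_le`
(`-Σ PQR ≤ ‖P‖‖Q‖‖R⁻‖ + ‖P‖‖Q⁻‖‖R‖ + ‖P⁻‖‖Q‖‖R‖`), the two-sided level-one inequality for spread quotient sets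
`sumSq_centered_pair_le_spread` (`‖P‖² ≤ 100(1+log n)·λ_A·log(4n·n!/α)/n`) and the deficit budget
`sumSq_deficit_pair_le` (`‖P⁻‖² ≤ 100(1+log n)·log(4n·n!/α)/n`) give

* `heavyQuotients` —
  `2N - n! - n!√(n!)/√D ≤ 2(n-1)·N·(‖a‖‖b‖‖c⁻‖ + ‖a‖‖b⁻‖‖c‖ + ‖a⁻‖‖b‖‖c‖)` with the six norms replaced by these
  bounds, `D = n(n-1)/6`; in round numbers
  `2N - n! - 2.5·n!^{3/2}/n ≤ 2000·N·√(L_A L_B L_C)·(√(λ_Aλ_B) + √(λ_Bλ_C) + √(λ_Cλ_A))/√n`,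
  `L_X = (1+log n)·log(4n·n!/|X|)`.

It contains `lopsidedNearWall` (the case `λ = n!/α`, where the spread bound is the excess cap up to the logarithm)
and `spreadTriple_nearWall` (one common `λ`, no deficit factor, `λ^{3/2}` instead of `λ`). Consequence (next file):
a TPP triple violating the crux inequality at an exponent `C < 1` has TWO point-heavy quotient sets,
`λ_Aλ_B ≥ n/polylog(n)` for some two of the three — the entry point of the point/spread dichotomy at level one.
-/

namespace Summit.MatrixMultiplication.MatrixMultiplication.Theorems.PolynomialSlack

open scoped BigOperators
open Literature.Combinatorics.Additive (TripleProductProperty)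

-- `Summit.<Summit>.<Problem>` is the tree's mandated summit-side namespace (CONVENTIONS §2); for
-- this single-conjunct summit the two coincide, so each declaration silences `dupNamespace`.
set_option linter.dupNamespace false

set_option maxHeartbeats 1600000 in
/-- **Heavy quotients (near-wall inequality with spread parameters).** For `n ≥ 40`, a parity-pure TPP triple
`S, T, U ⊆ S_n` with `N = |S||T||U|`, `α = |S||T|`, `β = |T||U|`, `γ = |U||S|`, and reals `λ_A, λ_B, λ_C ≥ 1`
with `m_{ST}(i,j) ≤ λ_A α/n`, `m_{TU}(i,j) ≤ λ_B β/n`, `m_{US}(i,j) ≤ λ_C γ/n` for all `i, j`: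
`2N - n! - n!√(n!)/√(n(n-1)/6) ≤ 2(n-1)·N·(x_A x_B d_C + x_A d_B x_C + d_A x_B x_C)` where
`x_X = √(100(1+log n)·λ_X·log(4n·n!/|X|)/n)` and `d_X = √(100·((1+log n)·log(4n·n!/|X|))/n)`. [folklore] -/
theorem heavyQuotients (n : ℕ) (hn : 40 ≤ n) (S T U : Finset (Equiv.Perm (Fin n)))
    (hTPP : TripleProductProperty S T U)
    (hS : ∀ s ∈ S, ∀ s' ∈ S, Equiv.Perm.sign s = Equiv.Perm.sign s')
    (hT : ∀ t ∈ T, ∀ t' ∈ T, Equiv.Perm.sign t = Equiv.Perm.sign t')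
    (hU : ∀ u ∈ U, ∀ u' ∈ U, Equiv.Perm.sign u = Equiv.Perm.sign u')
    (lamA lamB lamC : ℝ) (hlamA : 1 ≤ lamA) (hlamB : 1 ≤ lamB) (hlamC : 1 ≤ lamC)
    (hA : ∀ i j : Fin n, (((S ×ˢ T).filter fun st => st.2 j = st.1 i).card : ℝ) ≤ lamA * (S.card * T.card : ℕ) / n)
    (hB : ∀ i j : Fin n, (((T ×ˢ U).filter fun tu => tu.2 j = tu.1 i).card : ℝ) ≤ lamB * (T.card * U.card : ℕ) / n)
    (hC : ∀ i j : Fin n, (((U ×ˢ S).filter fun us => us.2 j = us.1 i).card : ℝ) ≤ lamC * (U.card * S.card : ℕ) / n) :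
    2 * ((S.card * T.card * U.card : ℕ) : ℝ) - (n.factorial : ℝ) -
        (n.factorial : ℝ) * Real.sqrt (n.factorial : ℝ) / Real.sqrt (((n * (n - 1) : ℕ) : ℝ) / 6) ≤
      2 * ((n : ℝ) - 1) * ((S.card * T.card * U.card : ℕ) : ℝ) *
        (Real.sqrt (100 * (1 + Real.log n) * lamA * Real.log (4 * n * n.factorial / (S.card * T.card : ℕ)) / n) *
            Real.sqrt (100 * (1 + Real.log n) * lamB * Real.log (4 * n * n.factorial / (T.card * U.card : ℕ)) / n) *
            Real.sqrt (100 * ((1 + Real.log n) * Real.log (4 * n * n.factorial / (U.card * S.card : ℕ))) / n) +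
          Real.sqrt (100 * (1 + Real.log n) * lamA * Real.log (4 * n * n.factorial / (S.card * T.card : ℕ)) / n) *
            Real.sqrt (100 * ((1 + Real.log n) * Real.log (4 * n * n.factorial / (T.card * U.card : ℕ))) / n) *
            Real.sqrt (100 * (1 + Real.log n) * lamC * Real.log (4 * n * n.factorial / (U.card * S.card : ℕ)) / n) +
          Real.sqrt (100 * ((1 + Real.log n) * Real.log (4 * n * n.factorial / (S.card * T.card : ℕ))) / n) *
            Real.sqrt (100 * (1 + Real.log n) * lamB * Real.log (4 * n * n.factorial / (T.card * U.card : ℕ)) / n) *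
            Real.sqrt (100 * (1 + Real.log n) * lamC * Real.log (4 * n * n.factorial / (U.card * S.card : ℕ)) / n)) := by
  classical
  set N : ℕ := S.card * T.card * U.card with hN
  set P : ℝ := ((S.card * T.card * U.card : ℕ) : ℝ) with hP
  have hF0 : (0 : ℝ) < n.factorial := by exact_mod_cast n.factorial_pos
  have hn0 : n ≠ 0 := by omega
  have hn1 : 1 ≤ n := by omega
  have hnR : (0 : ℝ) < n := by exact_mod_cast Nat.pos_of_ne_zero hn0
  have hm : (0 : ℝ) < (n : ℝ) - 1 := by
    have : (40 : ℝ) ≤ n := by exact_mod_cast hn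
    linarith
  have hD0 : 0 < Real.sqrt (((n * (n - 1) : ℕ) : ℝ) / 6) := by
    apply Real.sqrt_pos.2; apply div_pos _ (by norm_num)
    have : 0 < n * (n - 1) := Nat.mul_pos (by omega) (by omega)
    exact_mod_cast this
  -- degenerate case
  by_cases hN0 : N = 0
  · have : P = 0 := by rw [hP, ← hN, hN0, Nat.cast_zero]
    rw [this]
    simp only [mul_zero, zero_mul, zero_sub]
    have h1 : 0 ≤ (n.factorial : ℝ) * Real.sqrt (n.factorial : ℝ) / Real.sqrt (((n * (n - 1) : ℕ) : ℝ) / 6) := by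
      positivity
    linarith
  have hSne : S.Nonempty := Finset.card_ne_zero.1 fun h => hN0 (by simp [hN, h])
  have hTne : T.Nonempty := Finset.card_ne_zero.1 fun h => hN0 (by simp [hN, h])
  have hUne : U.Nonempty := Finset.card_ne_zero.1 fun h => hN0 (by simp [hN, h])
  have hNpos : (0 : ℝ) < P := by rw [hP, ← hN]; exact_mod_cast Nat.pos_of_ne_zero hN0
  -- quotient sizes
  set α : ℝ := ((S.card * T.card : ℕ) : ℝ) with hα
  set β : ℝ := ((T.card * U.card : ℕ) : ℝ) with hβ
  set γ : ℝ := ((U.card * S.card : ℕ) : ℝ) with hγ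
  have hα0 : 0 < α := by rw [hα]; exact_mod_cast Nat.mul_pos hSne.card_pos hTne.card_pos
  have hβ0 : 0 < β := by rw [hβ]; exact_mod_cast Nat.mul_pos hTne.card_pos hUne.card_pos
  have hγ0 : 0 < γ := by rw [hγ]; exact_mod_cast Nat.mul_pos hUne.card_pos hSne.card_pos
  have hNsq : α * β * γ = P ^ 2 := by rw [hα, hβ, hγ, hP]; push_cast; ring
  -- injectivity of the three quotient maps
  have hinjA := injOn_quot_first hTPP hUne
  have hinjB := injOn_quot_second hTPP hSne
  have hinjC := injOn_quot_first hTPP.rotate.rotate hTne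
  -- (1) the pinning and the six-fold count as a triple sum
  have hpin := levelOnePinning n hn S T U hTPP hS hT hU
  set mA : Fin n → Fin n → ℝ := fun i j => (((S ×ˢ T).filter fun st => st.2 j = st.1 i).card : ℝ) with hmA
  set mB : Fin n → Fin n → ℝ := fun i j => (((T ×ˢ U).filter fun tu => tu.2 j = tu.1 i).card : ℝ) with hmB
  set mC : Fin n → Fin n → ℝ := fun i j => (((U ×ˢ S).filter fun us => us.2 j = us.1 i).card : ℝ) with hmC
  have hT3 : ((∑ y ∈ ((S ×ˢ T) ×ˢ (T ×ˢ U)) ×ˢ (U ×ˢ S),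
      (Finset.univ.filter fun p : Fin n =>
        (y.1.1.1⁻¹ * y.1.1.2 * (y.1.2.1⁻¹ * y.1.2.2) * (y.2.1⁻¹ * y.2.2)) p = p).card : ℕ) : ℝ) =
      ∑ i : Fin n, ∑ j : Fin n, ∑ k : Fin n, mA i j * mB j k * mC k i := by
    rw [sixFoldFix_eq_tripleSum S T U]
    push_cast
    refine Finset.sum_congr rfl fun i _ => ?_
    rw [Finset.sum_comm]
    refine Finset.sum_congr rfl fun j _ => Finset.sum_congr rfl fun k _ => ?_
    simp only [hmA, hmB, hmC]; ring
  -- (2) normalised arrays and the centring identity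
  set a : Fin n → Fin n → ℝ := fun i j => mA i j / α with ha
  set b : Fin n → Fin n → ℝ := fun i j => mB i j / β with hb
  set c : Fin n → Fin n → ℝ := fun i j => mC i j / γ with hc
  have hsndA : ∀ i, ∑ j : Fin n, mA i j = α := fun i => by
    have h : ∑ j : Fin n, ((((S ×ˢ T).filter fun st => st.2 j = st.1 i).card : ℕ) : ℝ) =
        ((S.card * T.card : ℕ) : ℝ) := by exact_mod_cast sum_pairMarginal_snd S T i
    exact h
  have hsndB : ∀ i, ∑ j : Fin n, mB i j = β := fun i => by
    have h : ∑ j : Fin n, ((((T ×ˢ U).filter fun tu => tu.2 j = tu.1 i).card : ℕ) : ℝ) =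
        ((T.card * U.card : ℕ) : ℝ) := by exact_mod_cast sum_pairMarginal_snd T U i
    exact h
  have hfstB : ∀ j, ∑ i : Fin n, mB i j = β := fun j => by
    have h : ∑ i : Fin n, ((((T ×ˢ U).filter fun tu => tu.2 j = tu.1 i).card : ℕ) : ℝ) =
        ((T.card * U.card : ℕ) : ℝ) := by exact_mod_cast sum_pairMarginal_fst T U j
    exact h
  have hsndC : ∀ i, ∑ j : Fin n, mC i j = γ := fun i => by
    have h : ∑ j : Fin n, ((((U ×ˢ S).filter fun us => us.2 j = us.1 i).card : ℕ) : ℝ) =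
        ((U.card * S.card : ℕ) : ℝ) := by exact_mod_cast sum_pairMarginal_snd U S i
    exact h
  have hfstC : ∀ j, ∑ i : Fin n, mC i j = γ := fun j => by
    have h : ∑ i : Fin n, ((((U ×ˢ S).filter fun us => us.2 j = us.1 i).card : ℕ) : ℝ) =
        ((U.card * S.card : ℕ) : ℝ) := by exact_mod_cast sum_pairMarginal_fst U S j
    exact h
  have har : ∀ i, ∑ j : Fin n, a i j = 1 := fun i => by
    simp only [ha]; rw [← Finset.sum_div, div_eq_one_iff_eq hα0.ne', hsndA]
  have hbr : ∀ j, ∑ k : Fin n, b j k = 1 := fun j => by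
    simp only [hb]; rw [← Finset.sum_div, div_eq_one_iff_eq hβ0.ne', hsndB]
  have hbc : ∀ k, ∑ j : Fin n, b j k = 1 := fun k => by
    simp only [hb]; rw [← Finset.sum_div, div_eq_one_iff_eq hβ0.ne', hfstB]
  have hcr : ∀ k, ∑ i : Fin n, c k i = 1 := fun k => by
    simp only [hc]; rw [← Finset.sum_div, div_eq_one_iff_eq hγ0.ne', hsndC]
  have hcc : ∀ i, ∑ k : Fin n, c k i = 1 := fun i => by
    simp only [hc]; rw [← Finset.sum_div, div_eq_one_iff_eq hγ0.ne', hfstC]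
  have hcen := centered_tripleSum_eq hn0 a b c har hbr hbc hcr hcc
  have habc : ∑ i : Fin n, ∑ j : Fin n, ∑ k : Fin n, a i j * b j k * c k i =
      (∑ i : Fin n, ∑ j : Fin n, ∑ k : Fin n, mA i j * mB j k * mC k i) / (α * β * γ) := by
    rw [Finset.sum_div]
    refine Finset.sum_congr rfl fun i _ => ?_
    rw [Finset.sum_div]
    refine Finset.sum_congr rfl fun j _ => ?_
    rw [Finset.sum_div]
    refine Finset.sum_congr rfl fun k _ => ?_
    simp only [ha, hb, hc]
    field_simp
  -- (3) the positivity inequality for the centred arrays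
  have hneg := neg_tripleSum_le (fun i j => a i j - 1 / n) (fun j k => b j k - 1 / n)
    (fun k i => c k i - 1 / n)
  -- spread (two-sided) and deficit (one-sided) bounds for the three quotient sets
  have hPA := Real.sqrt_le_sqrt (sumSq_centered_pair_le_spread hn1 hSne hTne hinjA lamA hlamA hA)
  have hPB := Real.sqrt_le_sqrt (sumSq_centered_pair_le_spread hn1 hTne hUne hinjB lamB hlamB hB)
  have hPC := Real.sqrt_le_sqrt (sumSq_centered_pair_le_spread hn1 hUne hSne hinjC lamC hlamC hC)
  have hDA := Real.sqrt_le_sqrt (sumSq_deficit_pair_le hn hSne hTne hinjA)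
  have hDB := Real.sqrt_le_sqrt (sumSq_deficit_pair_le hn hTne hUne hinjB)
  have hDC := Real.sqrt_le_sqrt (sumSq_deficit_pair_le hn hUne hSne hinjC)
  rw [← hα] at hPA hDA
  rw [← hβ] at hPB hDB
  rw [← hγ] at hPC hDC
  change Real.sqrt (∑ i : Fin n, ∑ j : Fin n, (a i j - 1 / n) ^ 2) ≤ _ at hPA
  change Real.sqrt (∑ i : Fin n, ∑ j : Fin n, (b i j - 1 / n) ^ 2) ≤ _ at hPB
  change Real.sqrt (∑ i : Fin n, ∑ j : Fin n, (c i j - 1 / n) ^ 2) ≤ _ at hPC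
  change Real.sqrt (∑ i : Fin n, ∑ j : Fin n, (max 0 (-(a i j - 1 / n))) ^ 2) ≤ _ at hDA
  change Real.sqrt (∑ i : Fin n, ∑ j : Fin n, (max 0 (-(b i j - 1 / n))) ^ 2) ≤ _ at hDB
  change Real.sqrt (∑ i : Fin n, ∑ j : Fin n, (max 0 (-(c i j - 1 / n))) ^ 2) ≤ _ at hDC
  -- names for the six bounds
  set xA : ℝ := Real.sqrt (100 * (1 + Real.log n) * lamA * Real.log (4 * n * n.factorial / α) / n) with hxA
  set xB : ℝ := Real.sqrt (100 * (1 + Real.log n) * lamB * Real.log (4 * n * n.factorial / β) / n) with hxB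
  set xC : ℝ := Real.sqrt (100 * (1 + Real.log n) * lamC * Real.log (4 * n * n.factorial / γ) / n) with hxC
  set dA : ℝ := Real.sqrt (100 * ((1 + Real.log n) * Real.log (4 * n * n.factorial / α)) / n) with hdA
  set dB : ℝ := Real.sqrt (100 * ((1 + Real.log n) * Real.log (4 * n * n.factorial / β)) / n) with hdB
  set dC : ℝ := Real.sqrt (100 * ((1 + Real.log n) * Real.log (4 * n * n.factorial / γ)) / n) with hdC
  have hxA0 : 0 ≤ xA := Real.sqrt_nonneg _
  have hxB0 : 0 ≤ xB := Real.sqrt_nonneg _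
  have hxC0 : 0 ≤ xC := Real.sqrt_nonneg _
  have hdA0 : 0 ≤ dA := Real.sqrt_nonneg _
  have hdB0 : 0 ≤ dB := Real.sqrt_nonneg _
  have hdC0 : 0 ≤ dC := Real.sqrt_nonneg _
  -- the three cyclic terms
  have hX1 : Real.sqrt (∑ i : Fin n, ∑ j : Fin n, (a i j - 1 / n) ^ 2) *
      Real.sqrt (∑ j : Fin n, ∑ k : Fin n, (b j k - 1 / n) ^ 2) *
        Real.sqrt (∑ k : Fin n, ∑ i : Fin n, (max 0 (-(c k i - 1 / n))) ^ 2) ≤ xA * xB * dC :=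
    mul_le_mul (mul_le_mul hPA hPB (Real.sqrt_nonneg _) hxA0) hDC (Real.sqrt_nonneg _) (by positivity)
  have hX2 : Real.sqrt (∑ i : Fin n, ∑ j : Fin n, (a i j - 1 / n) ^ 2) *
      Real.sqrt (∑ j : Fin n, ∑ k : Fin n, (max 0 (-(b j k - 1 / n))) ^ 2) *
        Real.sqrt (∑ k : Fin n, ∑ i : Fin n, (c k i - 1 / n) ^ 2) ≤ xA * dB * xC :=
    mul_le_mul (mul_le_mul hPA hDB (Real.sqrt_nonneg _) hxA0) hPC (Real.sqrt_nonneg _) (by positivity)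
  have hX3 : Real.sqrt (∑ i : Fin n, ∑ j : Fin n, (max 0 (-(a i j - 1 / n))) ^ 2) *
      Real.sqrt (∑ j : Fin n, ∑ k : Fin n, (b j k - 1 / n) ^ 2) *
        Real.sqrt (∑ k : Fin n, ∑ i : Fin n, (c k i - 1 / n) ^ 2) ≤ dA * xB * xC :=
    mul_le_mul (mul_le_mul hDA hPB (Real.sqrt_nonneg _) hdA0) hPC (Real.sqrt_nonneg _) (by positivity)
  -- (4) assemble: `2N² - n!N - N n!√(n!)/√D ≤ 2(n-1)(N² - T₃) = 2(n-1)N²·(-Σ PQR) ≤ 2(n-1)N²·(X1+X2+X3)`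
  have hmain : 2 * ((n : ℝ) - 1) * (P ^ 2 -
      ∑ i : Fin n, ∑ j : Fin n, ∑ k : Fin n, mA i j * mB j k * mC k i) =
      2 * ((n : ℝ) - 1) * P ^ 2 *
        (-(∑ i : Fin n, ∑ j : Fin n, ∑ k : Fin n, (a i j - 1 / n) * (b j k - 1 / n) * (c k i - 1 / n))) := by
    have hP2 : P ^ 2 ≠ 0 := pow_ne_zero 2 hNpos.ne'
    rw [hcen, habc, hNsq]
    field_simp
    ring
  rw [hT3, Nat.cast_pow, ← hP] at hpin
  have h2 : 2 * ((n : ℝ) - 1) * P ^ 2 *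
      (-(∑ i : Fin n, ∑ j : Fin n, ∑ k : Fin n, (a i j - 1 / n) * (b j k - 1 / n) * (c k i - 1 / n))) ≤
      2 * ((n : ℝ) - 1) * P ^ 2 * (xA * xB * dC + xA * dB * xC + dA * xB * xC) := by
    have hcoef : 0 ≤ 2 * ((n : ℝ) - 1) * P ^ 2 := by positivity
    refine mul_le_mul_of_nonneg_left (hneg.trans ?_) hcoef
    linarith [hX1, hX2, hX3]
  have hfin : 2 * P ^ 2 - (n.factorial : ℝ) * P -
      P * ((n.factorial : ℝ) * Real.sqrt (n.factorial : ℝ)) / Real.sqrt (((n * (n - 1) : ℕ) : ℝ) / 6) ≤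
      P * (2 * ((n : ℝ) - 1) * P * (xA * xB * dC + xA * dB * xC + dA * xB * xC)) := by
    have := hpin.trans (le_of_eq hmain)
    have e : 2 * ((n : ℝ) - 1) * P ^ 2 * (xA * xB * dC + xA * dB * xC + dA * xB * xC) =
        P * (2 * ((n : ℝ) - 1) * P * (xA * xB * dC + xA * dB * xC + dA * xB * xC)) := by ring
    linarith
  -- divide by `P > 0`
  have hdiv : 2 * P - (n.factorial : ℝ) -
      ((n.factorial : ℝ) * Real.sqrt (n.factorial : ℝ)) / Real.sqrt (((n * (n - 1) : ℕ) : ℝ) / 6) ≤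
      2 * ((n : ℝ) - 1) * P * (xA * xB * dC + xA * dB * xC + dA * xB * xC) := by
    have e : P * (2 * P - (n.factorial : ℝ) -
        ((n.factorial : ℝ) * Real.sqrt (n.factorial : ℝ)) / Real.sqrt (((n * (n - 1) : ℕ) : ℝ) / 6)) =
        2 * P ^ 2 - (n.factorial : ℝ) * P -
          P * ((n.factorial : ℝ) * Real.sqrt (n.factorial : ℝ)) / Real.sqrt (((n * (n - 1) : ℕ) : ℝ) / 6) := by
      ring
    have h' : P * (2 * P - (n.factorial : ℝ) -
        ((n.factorial : ℝ) * Real.sqrt (n.factorial : ℝ)) / Real.sqrt (((n * (n - 1) : ℕ) : ℝ) / 6)) ≤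
        P * (2 * ((n : ℝ) - 1) * P * (xA * xB * dC + xA * dB * xC + dA * xB * xC)) := by
      rw [e]; exact hfin
    exact le_of_mul_le_mul_left h' hNpos
  have e2 : (n.factorial : ℝ) * Real.sqrt (n.factorial : ℝ) / Real.sqrt (((n * (n - 1) : ℕ) : ℝ) / 6) =
      ((n.factorial : ℝ) * Real.sqrt (n.factorial : ℝ)) / Real.sqrt (((n * (n - 1) : ℕ) : ℝ) / 6) := by ring
  rw [e2]
  linarith [hdiv]

end Summit.MatrixMultiplication.MatrixMultiplication.Theorems.PolynomialSlack
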